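import Summits.KontsevichZagierPeriods.KontsevichZagierPeriods.Theorems.MultiplicationThree.Negative.Calibration

/-!
# `MultiplicationThree` (stmt-KontsevichZagierPeriods-3598) — negative knowledge, part 6b: calibration at `s = 1` — the shear and the conclusion

Second half of part 6 (part 6 = `Calibration.lean`: the constant representation and the Kummer move).
`multiplicationThree_at_one`: at `s = 1` the crux HOLDS, by TWO rule-(2) moves: the Kummer map
`K(u,v) = (u^{1/3}, v^{2/3})` (`[box, u^{-2/3}v^{-1/3}] ~ [box, 9/2]`, Jacobian
`(2/9)u^{-2/3}v^{-1/3}`) and the shear `M(u,v) = (3(1−√(1−u)), 3√(1−u)·v)`, a `ℚ`-semialgebraic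
bijection of the box onto the triangle with CONSTANT Jacobian `9/2` (`[box, 9/2] ~ [triangle, 1]`).
Consequence for any would-be refutation of the crux: a separating additive invariant of
`KZ.relations` must vanish on the pair at `s = 1` — it must be genuinely `s`-dependent.
(cdisprove gen 1; sorry-free, standard axioms.)
-/

noncomputable section

open MeasureTheory Set Real
open scoped BigOperators

namespace Summit.KontsevichZagierPeriods.TerasomaMultiplication.MultiplicationThreeNegative

open Literature.NumberTheory.Transcendental
open Literature.NumberTheory.Transcendental.KZ
open Literature.ModelTheory.ExponentialFields (IsSemialgebraic)
open MvPolynomial (aeval X C)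
open Summit.KontsevichZagierPeriods.KontsevichZagierPeriods.Theses.TerasomaMultiplication
  (MultiplicationThree)

/-! ### The shear `M(u,v) = (3(1-√(1-u)), 3√(1-u)·v)`: constant Jacobian `9/2`, box → triangle -/

/-- The shear. [folklore] -/
def M (x : Fin 2 → ℝ) : Fin 2 → ℝ := ![3 * (1 - Real.sqrt (1 - x 0)), 3 * Real.sqrt (1 - x 0) * x 1]

/-- First component. [folklore] -/
@[simp] theorem M_apply_zero (x : Fin 2 → ℝ) : M x 0 = 3 * (1 - Real.sqrt (1 - x 0)) := rfl

/-- Second component. [folklore] -/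
@[simp] theorem M_apply_one (x : Fin 2 → ℝ) : M x 1 = 3 * Real.sqrt (1 - x 0) * x 1 := rfl

/-- The Jacobian matrix of the shear. [folklore] -/
def mJac (x : Fin 2 → ℝ) : Matrix (Fin 2) (Fin 2) ℝ :=
  !![3 / (2 * Real.sqrt (1 - x 0)), 0; -(3 * x 1) / (2 * Real.sqrt (1 - x 0)), 3 * Real.sqrt (1 - x 0)]

/-- The derivative of the shear. [folklore] -/
def M' (x : Fin 2 → ℝ) : (Fin 2 → ℝ) →L[ℝ] (Fin 2 → ℝ) :=
  LinearMap.toContinuousLinearMap (Matrix.toLin' (mJac x))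

/-- `DM` applied to a vector, first component. [folklore] -/
@[simp] theorem M'_apply_zero (x v : Fin 2 → ℝ) : M' x v 0 = 3 / (2 * Real.sqrt (1 - x 0)) * v 0 := by
  change Matrix.toLin' (mJac x) v 0 = _
  rw [Matrix.toLin'_apply]
  simp [mJac, Matrix.mulVec, dotProduct, Fin.sum_univ_two]

/-- `DM` applied to a vector, second component. [folklore] -/
@[simp] theorem M'_apply_one (x v : Fin 2 → ℝ) :
    M' x v 1 = -(3 * x 1) / (2 * Real.sqrt (1 - x 0)) * v 0 + 3 * Real.sqrt (1 - x 0) * v 1 := by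
  change Matrix.toLin' (mJac x) v 1 = _
  rw [Matrix.toLin'_apply]
  simp [mJac, Matrix.mulVec, dotProduct, Fin.sum_univ_two]

/-- **The Jacobian of the shear is the CONSTANT `9/2`** on `{u < 1}`. [folklore] -/
theorem det_M' {x : Fin 2 → ℝ} (hx : x 0 < 1) : (M' x).det = 9/2 := by
  change LinearMap.det (Matrix.toLin' (mJac x)) = _
  rw [LinearMap.det_toLin', Matrix.det_fin_two]
  have hs : Real.sqrt (1 - x 0) ≠ 0 := Real.sqrt_ne_zero'.2 (by linarith)
  simp [mJac]
  field_simp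
  ring

/-- The shear is differentiable on `{u < 1}` with derivative `M'`. [folklore] -/
theorem hasFDerivAt_M {x : Fin 2 → ℝ} (hx : x 0 < 1) : HasFDerivAt M (M' x) x := by
  have h0 : HasFDerivAt (fun y : Fin 2 → ℝ => y 0)
      (ContinuousLinearMap.proj (R := ℝ) (φ := fun _ : Fin 2 => ℝ) 0) x := hasFDerivAt_apply 0 x
  have h1 : HasFDerivAt (fun y : Fin 2 → ℝ => y 1)
      (ContinuousLinearMap.proj (R := ℝ) (φ := fun _ : Fin 2 => ℝ) 1) x := hasFDerivAt_apply 1 x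
  have hne : 1 - x 0 ≠ 0 := by linarith
  have hg : HasFDerivAt (fun y : Fin 2 → ℝ => Real.sqrt (1 - y 0))
      ((ContinuousLinearMap.smulRight (1 : ℝ →L[ℝ] ℝ) (1 / (2 * Real.sqrt (1 - x 0)))).comp
        (-(ContinuousLinearMap.proj (R := ℝ) (φ := fun _ : Fin 2 => ℝ) 0))) x :=
    (Real.hasDerivAt_sqrt hne).hasFDerivAt.comp x (h0.const_sub 1)
  rw [hasFDerivAt_pi']
  refine Fin.forall_fin_two.mpr ⟨?_, ?_⟩
  · have hf : (fun y : Fin 2 → ℝ => M y 0) = fun y => 3 * (1 - Real.sqrt (1 - y 0)) :=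
      funext fun y => rfl
    rw [hf]
    refine ((hg.const_sub 1).const_mul (3:ℝ)).congr_fderiv (ContinuousLinearMap.ext fun v => ?_)
    simp
    ring
  · have hf : (fun y : Fin 2 → ℝ => M y 1) = fun y => 3 * Real.sqrt (1 - y 0) * y 1 :=
      funext fun y => rfl
    rw [hf]
    refine ((hg.const_mul (3:ℝ)).mul h1).congr_fderiv (ContinuousLinearMap.ext fun v => ?_)
    simp
    ring

/-- The shear is injective on the box. [folklore] -/
theorem injOn_M : InjOn M box := by
  intro x hx y hy hxy
  have e0 := congrFun hxy 0
  have e1 := congrFun hxy 1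
  simp only [M_apply_zero, M_apply_one] at e0 e1
  have hsx : 0 < Real.sqrt (1 - x 0) := Real.sqrt_pos.2 (sub_pos.2 (hx 0).2)
  have hs : Real.sqrt (1 - x 0) = Real.sqrt (1 - y 0) := by linarith
  have h0 : x 0 = y 0 := by
    have := (Real.sqrt_inj (sub_pos.2 (hx 0).2).le (sub_pos.2 (hy 0).2).le).1 hs
    linarith
  have h1 : x 1 = y 1 := by
    rw [← hs] at e1
    have hne : (3 : ℝ) * Real.sqrt (1 - x 0) ≠ 0 := by positivity
    exact mul_left_cancel₀ hne e1
  funext i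
  fin_cases i
  · exact h0
  · exact h1

/-- The shear maps the box ONTO the triangle. [folklore] -/
theorem image_M_box : M '' box = triangle := by
  ext y
  constructor
  · rintro ⟨x, hx, rfl⟩
    have hu := hx 0
    have hv := hx 1
    have hw0 : 0 < Real.sqrt (1 - x 0) := Real.sqrt_pos.2 (sub_pos.2 hu.2)
    have hw1 : Real.sqrt (1 - x 0) < 1 := by
      rw [Real.sqrt_lt' one_pos]; linarith [hu.1]
    refine ⟨?_, ?_, ?_⟩
    · simp only [M_apply_zero]; nlinarith
    · simp only [M_apply_one]; exact mul_pos (by positivity) hv.1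
    · simp only [M_apply_zero, M_apply_one]
      nlinarith [mul_pos hw0 (sub_pos.2 hv.2)]
  · rintro ⟨hy0, hy1, hy2⟩
    have ha3 : 0 < 3 - y 0 := by linarith
    set w : ℝ := (3 - y 0) / 3 with hw
    have hw0 : 0 < w := by positivity
    have hw1 : w < 1 := by rw [hw, div_lt_one (by norm_num)]; linarith
    have hsq : Real.sqrt (1 - (1 - w ^ 2)) = w := by
      rw [show (1:ℝ) - (1 - w ^ 2) = w ^ 2 by ring, Real.sqrt_sq hw0.le]
    refine ⟨![1 - w ^ 2, y 1 / (3 - y 0)], Fin.forall_fin_two.mpr ⟨?_, ?_⟩, ?_⟩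
    · change 1 - w ^ 2 ∈ Ioo (0:ℝ) 1
      constructor <;> nlinarith
    · change y 1 / (3 - y 0) ∈ Ioo (0:ℝ) 1
      exact ⟨div_pos hy1 ha3, by rw [div_lt_one ha3]; linarith⟩
    · funext i
      fin_cases i
      · change 3 * (1 - Real.sqrt (1 - (1 - w ^ 2))) = y 0
        rw [hsq, hw]; ring
      · change 3 * Real.sqrt (1 - (1 - w ^ 2)) * (y 1 / (3 - y 0)) = y 1
        rw [hsq, hw]; field_simp

/-- The first component of the shear is `ℚ`-semialgebraic on the box: its graph is
`{0 < 3 - y, (3 - y)² = 9(1 - u)}` over the box. [folklore] -/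
theorem isSemialgebraicFunOn_M_zero : IsSemialgebraicFunOn ℚ box (fun x => M x 0) := by
  rw [isSemialgebraicFunOn_iff]
  have h3 : ∀ w : Fin 3 → ℝ, aeval w (3 : MvPolynomial (Fin 3) ℚ) = (3 : ℝ) := fun w => by
    rw [show (3 : MvPolynomial (Fin 3) ℚ) = C 3 by simp [map_ofNat], MvPolynomial.aeval_C]; simp
  have h9 : ∀ w : Fin 3 → ℝ, aeval w (9 : MvPolynomial (Fin 3) ℚ) = (9 : ℝ) := fun w => by
    rw [show (9 : MvPolynomial (Fin 3) ℚ) = C 9 by simp [map_ofNat], MvPolynomial.aeval_C]; simp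
  have hset : {w : Fin (2 + 1) → ℝ | Fin.init w ∈ box ∧ w (Fin.last 2) = M (Fin.init w) 0} =
      {w : Fin (2 + 1) → ℝ | Fin.init w ∈ box} ∩
        ({w | 0 < aeval w ((3 : MvPolynomial (Fin 3) ℚ) - X (Fin.last 2))} ∩
         {w | aeval w (((3 : MvPolynomial (Fin 3) ℚ) - X (Fin.last 2)) ^ 2 -
            9 * (1 - X (Fin.castSucc 0))) = 0}) := by
    ext w
    simp only [mem_setOf_eq, mem_inter_iff, map_sub, map_pow, map_mul, map_one,
      MvPolynomial.aeval_X, h3, h9, M_apply_zero, sub_eq_zero]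
    have hi0 : Fin.init w 0 = w (Fin.castSucc 0) := rfl
    constructor
    · rintro ⟨hb, hy⟩
      have hu : w (Fin.castSucc 0) < 1 := by have := (hb 0).2; rwa [hi0] at this
      have hs0 : 0 < Real.sqrt (1 - w (Fin.castSucc 0)) := Real.sqrt_pos.2 (by linarith)
      refine ⟨hb, ?_, ?_⟩
      · rw [hy, hi0]; linarith
      · rw [hy, hi0]
        have := Real.sq_sqrt (show (0:ℝ) ≤ 1 - w (Fin.castSucc 0) by linarith)
        nlinarith [this]
    · rintro ⟨hb, hpos, heq⟩
      refine ⟨hb, ?_⟩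
      have hu : w (Fin.castSucc 0) < 1 := by have := (hb 0).2; rwa [hi0] at this
      rw [hi0]
      have hsqrt : Real.sqrt (1 - w (Fin.castSucc 0)) = (3 - w (Fin.last 2)) / 3 := by
        rw [Real.sqrt_eq_iff_eq_sq (by linarith) (by linarith)]
        nlinarith [heq]
      rw [hsqrt]; ring
  rw [hset]
  exact isSemialgebraic_box.setOf_init_mem.inter
    ((Literature.ModelTheory.ExponentialFields.isSemialgebraic_setOf_eval_pos _).inter
      (Literature.ModelTheory.ExponentialFields.isSemialgebraic_setOf_eval_eq_zero _))

/-- The second component of the shear is `ℚ`-semialgebraic on the box: its graph is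
`{0 < y, y² = 9(1 - u)v²}` over the box. [folklore] -/
theorem isSemialgebraicFunOn_M_one : IsSemialgebraicFunOn ℚ box (fun x => M x 1) := by
  rw [isSemialgebraicFunOn_iff]
  have h9 : ∀ w : Fin 3 → ℝ, aeval w (9 : MvPolynomial (Fin 3) ℚ) = (9 : ℝ) := fun w => by
    rw [show (9 : MvPolynomial (Fin 3) ℚ) = C 9 by simp [map_ofNat], MvPolynomial.aeval_C]; simp
  have hset : {w : Fin (2 + 1) → ℝ | Fin.init w ∈ box ∧ w (Fin.last 2) = M (Fin.init w) 1} =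
      {w : Fin (2 + 1) → ℝ | Fin.init w ∈ box} ∩
        ({w | 0 < aeval w (X (Fin.last 2) : MvPolynomial (Fin 3) ℚ)} ∩
         {w | aeval w ((X (Fin.last 2) : MvPolynomial (Fin 3) ℚ) ^ 2 -
            9 * (1 - X (Fin.castSucc 0)) * X (Fin.castSucc 1) ^ 2) = 0}) := by
    ext w
    simp only [mem_setOf_eq, mem_inter_iff, map_sub, map_pow, map_mul, map_one,
      MvPolynomial.aeval_X, h9, M_apply_one, sub_eq_zero]
    have hi0 : Fin.init w 0 = w (Fin.castSucc 0) := rfl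
    have hi1 : Fin.init w 1 = w (Fin.castSucc 1) := rfl
    constructor
    · rintro ⟨hb, hy⟩
      have hu : w (Fin.castSucc 0) < 1 := by have := (hb 0).2; rwa [hi0] at this
      have hv : 0 < w (Fin.castSucc 1) := by have := (hb 1).1; rwa [hi1] at this
      have hs0 : 0 < Real.sqrt (1 - w (Fin.castSucc 0)) := Real.sqrt_pos.2 (by linarith)
      refine ⟨hb, ?_, ?_⟩
      · rw [hy, hi0, hi1]; positivity
      · rw [hy, hi0, hi1]
        have := Real.sq_sqrt (show (0:ℝ) ≤ 1 - w (Fin.castSucc 0) by linarith)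
        nlinarith [this]
    · rintro ⟨hb, hpos, heq⟩
      refine ⟨hb, ?_⟩
      have hu : w (Fin.castSucc 0) < 1 := by have := (hb 0).2; rwa [hi0] at this
      have hv : 0 < w (Fin.castSucc 1) := by have := (hb 1).1; rwa [hi1] at this
      rw [hi0, hi1]
      have hs0 : 0 < Real.sqrt (1 - w (Fin.castSucc 0)) := Real.sqrt_pos.2 (by linarith)
      -- both sides positive with equal squares
      have hsq : (3 * Real.sqrt (1 - w (Fin.castSucc 0)) * w (Fin.castSucc 1)) ^ 2 =
          w (Fin.last 2) ^ 2 := by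
        rw [mul_pow, mul_pow, Real.sq_sqrt (show (0:ℝ) ≤ 1 - w (Fin.castSucc 0) by linarith)]
        linarith [heq]
      have hp : 0 < 3 * Real.sqrt (1 - w (Fin.castSucc 0)) * w (Fin.castSucc 1) := by positivity
      nlinarith [hsq, hp, hpos, sq_nonneg (3 * Real.sqrt (1 - w (Fin.castSucc 0)) * w (Fin.castSucc 1) - w (Fin.last 2)),
        sq_nonneg (3 * Real.sqrt (1 - w (Fin.castSucc 0)) * w (Fin.castSucc 1) + w (Fin.last 2))]
  rw [hset]
  exact isSemialgebraic_box.setOf_init_mem.inter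
    ((Literature.ModelTheory.ExponentialFields.isSemialgebraic_setOf_eval_pos _).inter
      (Literature.ModelTheory.ExponentialFields.isSemialgebraic_setOf_eval_eq_zero _))

/-- The shear is a `ℚ`-semialgebraic map on the box. [folklore] -/
theorem isSemialgebraicMapOn_M : IsSemialgebraicMapOn ℚ box M :=
  IsSemialgebraicMapOn.of_forall isSemialgebraic_box
    (Fin.forall_fin_two.mpr ⟨isSemialgebraicFunOn_M_zero, isSemialgebraicFunOn_M_one⟩)

/-- **Move 2 (shear)**: `[box, 9/2] − [triangle, 1] ∈ changeOfVariablesRel` (`1 = (σ₁σ₂(3−σ₁−σ₂))⁰`). [cite: KontsevichZagier2001, §1.2 rule (2)] -/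
theorem constRep_sub_simplexRep_one_mem :
    of (constRep (9/2)) - of (simplexRep 1 one_pos) ∈ changeOfVariablesRel := by
  refine ⟨2, constRep (9/2), simplexRep 1 one_pos, M, M', isSemialgebraicMapOn_M,
    fun x hx => (hasFDerivAt_M (hx 0).2).hasFDerivWithinAt, injOn_M, image_M_box.symm,
    fun x hx => ?_, rfl⟩
  show ((9/2 : ℚ) : ℝ) = simplexFun 1 (M x) * |(M' x).det|
  rw [det_M' (hx 0).2]
  simp only [simplexFun, Rat.cast_one, sub_self, Real.rpow_zero, one_mul, Rat.cast_div,
    Rat.cast_ofNat]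
  norm_num

/-- **The crux holds at `s = 1`, by two rule-(2) moves.** [folklore] -/
theorem boxRep_one_equivalent_simplexRep_one :
    Equivalent (boxRep 1 one_pos) (simplexRep 1 one_pos) := by
  have h1 : Equivalent (boxRep 1 one_pos) (constRep (9/2)) :=
    changeOfVariablesRel_subset_relations boxRep_one_sub_constRep_mem
  have h2 : Equivalent (constRep (9/2)) (simplexRep 1 one_pos) :=
    changeOfVariablesRel_subset_relations constRep_sub_simplexRep_one_mem
  exact h1.trans h2

/-- **Calibration at `s = 1`**: every pair of representations satisfying the pinning hypotheses of the
crux at `s = 1` is KZ-equivalent (two changes of variables, plus integrand additivity with zero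
representations to move between choices of integrand off the pinned values). Any separating
invariant used in a refutation must therefore vanish here. [folklore] -/
theorem multiplicationThree_at_one (r r' : IntegralRep 2) (hr : r.domain = box)
    (hri : EqOn r.integrand (boxFun 1) r.domain) (hr' : r'.domain = triangle)
    (hri' : EqOn r'.integrand (simplexFun 1) r'.domain) : Equivalent r r' := by
  have h1 : of r - of (boxRep 1 one_pos) ∈ relations :=
    of_sub_of_mem_relations_of_eqOn (by rw [hr]; rfl) hri
  have h2 : of (simplexRep 1 one_pos) - of r' ∈ relations :=
    of_sub_of_mem_relations_of_eqOn (by rw [hr']; rfl) fun x hx => (hri' (by rw [hr']; exact hx)).symm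
  have : of r - of r' = (of r - of (boxRep 1 one_pos)) +
      (of (boxRep 1 one_pos) - of (simplexRep 1 one_pos)) + (of (simplexRep 1 one_pos) - of r') := by
    abel
  show of r - of r' ∈ relations
  rw [this]
  exact relations.add_mem (relations.add_mem h1 boxRep_one_equivalent_simplexRep_one) h2

end Summit.KontsevichZagierPeriods.TerasomaMultiplication.MultiplicationThreeNegative
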